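/-
Copyright (c) 2026. All rights reserved.
Released under Apache 2.0 license as described in the file LICENSE.
Authors: abc-iut cell, wave-6 cone prover seat abc-iut-w6-d025 (gen 5; L4-lead m151 (4) row «TWO-SIDED-SUM»), over
abc-iut-L4-t3's §5 interface (`LogFrobeniusCompatibility.lean`, `LogFrobeniusMonoAnalyticization.lean`,
`LogFrobeniusIotaAnMono.lean`); successor of this seat's `LogFrobeniusSettingProd.lean` (gen 4).
-/
import Literature.AnabelianGeometry.AbsoluteAnabelian.LogFrobeniusIotaAnMono
import Mathlib.CategoryTheory.Category.Cat
import HarnessLib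

/-!
# [AbsTopIII] Def 5.4 / 5.6 / Prop 5.8 (vii): the SUM of two log-Frobenius settings over a disjoint union of index sets
# (global categories = products; at each place ONLY its own factor's local row, the other factor carried as global data)

S. Mochizuki, *Topics in absolute anabelian geometry III*, J. Math. Sci. Univ. Tokyo 22 (2015) [MochizukiAbsTopIII2015];
manuscript `paper:url-5493eb38cbb7`: Def 5.4 (ii) p. 125 (the GLOBAL categories `Th•_T[Z]`, `Th•[Z]`), (iv) p. 127 ("`𝒩⊞_v`, `𝒩_v`
… that "lie over" `Th•[Z]`, for each vertex `ν` of `Γ⃗^log_v`" — an object of `𝒩_v` is a GLOBAL object together with LOCAL data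
AT `v`), (vii) p. 128, Def 5.6 (ii)–(iv) pp. 135–136, Prop 5.8 (vii) pp. 141–142 ("`w ∈ W_non` (respectively, `w ∈ W_arc`)";
`An⊢[𝒩⊢⊞] := ∏_v An⊢[𝒩⊢⊞_v]` fibred over `Th⊢[Z]`), Cor 5.10 (iv)(a) p. 147.

## Why (successor of `LogFrobeniusSettingProd.lean`, removing its honest limit (P2))

This seat's gen-4 `LogFrobeniusSetting.prod L₁ L₂` multiplies two settings over the SAME index set: at every place both
factors' local rows are present, so at a nonarchimedean place the archimedean factor contributes a FILLER slot and
conversely (limit (P2)), and a coherence datum for the product needs BOTH factors coherent at EVERY place — which the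
one-place-type genuine models never are at the other type's places.  Print's shape is different: `V(F_mod) = V^non ⊔ V^arc`,
the categories `Th•_T[Z]`, `ℰ•`, `An•`, `ℰ⊢`, `An⊢` are GLOBAL, and `𝒩⊞_v`, `𝒩_v`, `𝒩⊢⊞_v` carry local data AT `v` ONLY.  This
file builds exactly that:

* ★ `LogFrobeniusSetting.sum L₁ L₂ : LogFrobeniusSetting (V₁ ⊕ V₂) (Sum.elim isArc₁ isArc₂)` for
  `L₁ : LogFrobeniusSetting V₁ isArc₁`, `L₂ : LogFrobeniusSetting V₂ isArc₂`: global categories and equivalences the PRODUCTS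
  (`𝒳 = 𝒳₁ × 𝒳₂`, `ℰ• = ℰ₁ × ℰ₂`, `An•`, `ℰ⊢`, `An⊢` likewise); at a place `inl v` the local categories are
  `𝒩⊞_{inl v} := L₁.𝒩⊞_v × 𝒳₂`, `𝒩_{inl v} := L₁.𝒩_v × 𝒳₂`, `𝒩⊢⊞_{inl v} := L₁.𝒩⊢⊞_v × ℰ⊢₂`, `𝒩⊢_{inl v} := L₁.𝒩⊢_v × ℰ⊢₂`
  (the OTHER factor's global object rides along unchanged), with `λ⊞ = λ₁ × 𝟭`, `forget = forget₁ × 𝟭`,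
  `toE = toE₁ × proj₂`, `ι⊞ = ι₁ × (Λ ⟶ 𝟭)` (`twistToId`: the identity at a pre-log source, `logIsoId` at the post-log source),
  `monoNplus = monoNplus₁ × (proj₂ ⋙ monoAn₂)`, `ψ^{An⊢⊞} = ψ₁ × κ₂⁻¹`; symmetrically at `inr v`.  NO placeholder row anywhere;
* `sumMonoAnalyticizationHomotopies`, `sum_cor510MonoCores` (Cor 5.10 (iv)(a) for the sum from the factors' homotopies),
  `sumψOverIso`, `sumIotaAnMono` (abc-iut-L4-t3's `ι^{An⊢⊞}` add-on inherited componentwise: `ι₁ × 𝟙`).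

The Sum-indexed local categories are packaged as objects of Mathlib's `Cat` (`sumNplusCat`, …) so that NO instance is
declared in this file.  Consumer: `LogFrobeniusSettingSumCoherence.lean` (the coherence add-on of the sum from the factors'
coherence SEPARATELY — each over its own index set —, pinned Cor 5.10 (iv)(b)(c), the `η⊢`-square, and the genuine instances).

HONEST LIMITS (named): (P1) a sum of a one-prime nonarchimedean model and a one-field-functor archimedean model is still a
two-factor PROXY of the global theater, not a category of global Θ-data; (P3) the factors' own limits persist.  (P2) of the
product file is GONE.  MODEL-LEVEL; refereed pre-IUT material; nothing here bears on [IUTchIII] Cor. 3.12; no side taken;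
typed ≠ proved elsewhere.
-/

set_option autoImplicit false

noncomputable section

open CategoryTheory

universe u

namespace Literature.AnabelianGeometry.AbsoluteAnabelian

namespace LogFrobeniusSetting

/-! ## §0. The twist-to-identity transformation -/

section Twist

variable {Vmod : Type u} {isArc : Vmod → Bool} (L : LogFrobeniusSetting Vmod isArc)

/-- `Λ_ν ⟶ 𝟭`: the identity at a pre-log vertex (`Λ_ν = 𝟭`), `logIsoId : log ≅ 𝟭` at the post-log vertex (`Λ_ν = log`) — the
canonical identification used to let the OTHER factor's global object ride along an `ι⊞` of this factor.
[cite: MochizukiAbsTopIII2015, Def 5.4 (vii) p. 128] -/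
def twistToId : (c : Bool) → (frobeniusTwist L.log c ⟶ 𝟭 L.X)
  | false => 𝟙 (𝟭 L.X)
  | true => L.logIsoId.hom

/-- At a pre-log source the transformation is the identity. [cite: MochizukiAbsTopIII2015, Def 5.4 (vii) p. 128] -/
@[simp] theorem twistToId_false : L.twistToId false = 𝟙 (𝟭 L.X) := rfl

/-- At the post-log source it is `logIsoId`. [cite: MochizukiAbsTopIII2015, Def 5.4 (vii) p. 128] -/
@[simp] theorem twistToId_true : L.twistToId true = L.logIsoId.hom := rfl

/-- Its components are isomorphisms. [cite: MochizukiAbsTopIII2015, Def 5.4 (vii) p. 128] -/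
theorem isIso_twistToId (c : Bool) : IsIso (L.twistToId c) := by
  cases c
  · exact IsIso.id _
  · exact Iso.isIso_hom _

end Twist

/-! ## §1. The Sum-indexed local categories (as objects of `Cat`, so that no instance is declared) -/

section Local

variable {V₁ V₂ : Type u} {isArc₁ : V₁ → Bool} {isArc₂ : V₂ → Bool}
  (L₁ : LogFrobeniusSetting V₁ isArc₁) (L₂ : LogFrobeniusSetting V₂ isArc₂)

/-- `𝒩⊞_v` of the sum: `L₁.𝒩⊞_v × 𝒳₂` at `inl v`, `𝒳₁ × L₂.𝒩⊞_v` at `inr v` (a global object of the other factor rides along).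
[cite: MochizukiAbsTopIII2015, Def 5.4 (iv) p. 127] -/
def sumNplusCat : V₁ ⊕ V₂ → Cat.{u, u + 1}
  | .inl v => Cat.of (L₁.Nplus v × L₂.X)
  | .inr v => Cat.of (L₁.X × L₂.Nplus v)

/-- `𝒩_v` of the sum. [cite: MochizukiAbsTopIII2015, Def 5.4 (iv) p. 127] -/
def sumNCat : V₁ ⊕ V₂ → Cat.{u, u + 1}
  | .inl v => Cat.of (L₁.N v × L₂.X)
  | .inr v => Cat.of (L₁.X × L₂.N v)

/-- `𝒩⊢⊞_w` of the sum: `L₁.𝒩⊢⊞_w × ℰ⊢₂` at `inl w`, `ℰ⊢₁ × L₂.𝒩⊢⊞_w` at `inr w`. [cite: MochizukiAbsTopIII2015, Def 5.6 (iv) p. 136] -/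
def sumNmonoPlusCat : V₁ ⊕ V₂ → Cat.{u, u + 1}
  | .inl w => Cat.of (L₁.NmonoPlus w × L₂.Emono)
  | .inr w => Cat.of (L₁.Emono × L₂.NmonoPlus w)

/-- `𝒩⊢_w` of the sum. [cite: MochizukiAbsTopIII2015, Def 5.6 (iv) p. 136] -/
def sumNmonoCat : V₁ ⊕ V₂ → Cat.{u, u + 1}
  | .inl w => Cat.of (L₁.Nmono w × L₂.Emono)
  | .inr w => Cat.of (L₁.Emono × L₂.Nmono w)

/-- `𝒩⊞_v → 𝒩_v`: `forget₁ × 𝟭` resp. `𝟭 × forget₂`. [cite: MochizukiAbsTopIII2015, Def 5.4 (iv) p. 127] -/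
def sumForget : (v : V₁ ⊕ V₂) → (sumNplusCat L₁ L₂ v ⥤ sumNCat L₁ L₂ v)
  | .inl v => (L₁.forget v).prod (𝟭 L₂.X)
  | .inr v => (𝟭 L₁.X).prod (L₂.forget v)

/-- `𝒩_v → ℰ•`: `toE₁ × proj₂` resp. `proj₁ × toE₂` (the carried global object is projected to `ℰ•` here).
[cite: MochizukiAbsTopIII2015, Def 5.4 (iv) p. 127] -/
def sumToE : (v : V₁ ⊕ V₂) → (sumNCat L₁ L₂ v ⥤ L₁.E × L₂.E)
  | .inl v => (L₁.toE v).prod L₂.proj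
  | .inr v => L₁.proj.prod (L₂.toE v)

/-- `λ⊞_{v,ν}`: `λ₁ × 𝟭` resp. `𝟭 × λ₂`. [cite: MochizukiAbsTopIII2015, Def 5.4 (iv) p. 127] -/
def sumLam : (v : V₁ ⊕ V₂) → LogVertex (Sum.elim isArc₁ isArc₂ v) → (L₁.X × L₂.X ⥤ sumNplusCat L₁ L₂ v)
  | .inl v, ν => (L₁.lam v ν).prod (𝟭 L₂.X)
  | .inr v, ν => (𝟭 L₁.X).prod (L₂.lam v ν)

/-- `λ⊞_{v,ν}` lies over `Th•[Z] = ℰ₁ × ℰ₂`: `lamOver₁ × (𝟭 ⋙ 𝟭 ⋙ proj₂ ≅ proj₂)`. [cite: MochizukiAbsTopIII2015, Def 5.4 (iv) p. 127] -/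
def sumLamOver : (v : V₁ ⊕ V₂) → (ν : LogVertex (Sum.elim isArc₁ isArc₂ v)) →
    (sumLam L₁ L₂ v ν ⋙ sumForget L₁ L₂ v ⋙ sumToE L₁ L₂ v ≅ L₁.proj.prod L₂.proj)
  | .inl v, ν => NatIso.prod (L₁.lamOver v ν) (L₂.proj.leftUnitor ≪≫ L₂.proj.leftUnitor)
  | .inr v, ν => NatIso.prod (L₁.proj.leftUnitor ≪≫ L₁.proj.leftUnitor) (L₂.lamOver v ν)

/-- The space-link and post-log functors of the sum coincide (factorwise). [cite: MochizukiAbsTopIII2015, Cor 5.5 p. 130] -/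
theorem sumLam_spaceLink_eq_postLog : ∀ v : V₁ ⊕ V₂,
    sumLam L₁ L₂ v (LogVertex.spaceLink (Sum.elim isArc₁ isArc₂ v)) =
      sumLam L₁ L₂ v (LogVertex.postLog (Sum.elim isArc₁ isArc₂ v))
  | .inl v => congrArg (fun F => F.prod (𝟭 L₂.X)) (L₁.lam_spaceLink_eq_postLog v)
  | .inr v => congrArg (fun F => (𝟭 L₁.X).prod F) (L₂.lam_spaceLink_eq_postLog v)

/-- The source of `ι⊞` in the sum at `inl v`: the twisted global functor composed with `λ₁ × 𝟭` is
`(Λ₁ ⋙ λ₁) × Λ₂`. [cite: MochizukiAbsTopIII2015, Def 5.4 (vii) p. 128] -/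
theorem twist_comp_sumLam_inl (c : Bool) (v : V₁) (ν : LogVertex (isArc₁ v)) :
    frobeniusTwist (L₁.log.prod L₂.log) c ⋙ sumLam L₁ L₂ (.inl v) ν =
      (frobeniusTwist L₁.log c ⋙ L₁.lam v ν).prod (frobeniusTwist L₂.log c) := by
  cases c <;> rfl

/-- The same at `inr v`. [cite: MochizukiAbsTopIII2015, Def 5.4 (vii) p. 128] -/
theorem twist_comp_sumLam_inr (c : Bool) (v : V₂) (ν : LogVertex (isArc₂ v)) :
    frobeniusTwist (L₁.log.prod L₂.log) c ⋙ sumLam L₁ L₂ (.inr v) ν =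
      (frobeniusTwist L₁.log c).prod (frobeniusTwist L₂.log c ⋙ L₂.lam v ν) := by
  cases c <;> rfl

/-- **`ι⊞_{v,ε}` of the sum**: `ι₁ × (Λ₂ ⟶ 𝟭)` at `inl v`, `(Λ₁ ⟶ 𝟭) × ι₂` at `inr v` — the other factor's global object rides
along through the canonical identification of its twist with the identity. [cite: MochizukiAbsTopIII2015, Def 5.4 (vii) p. 128] -/
def sumIota : (v : V₁ ⊕ V₂) → {ν₁ ν₂ : LogVertex (Sum.elim isArc₁ isArc₂ v)} → LogEdge (Sum.elim isArc₁ isArc₂ v) ν₁ ν₂ →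
    (frobeniusTwist (L₁.log.prod L₂.log) ν₁.isPostLog ⋙ sumLam L₁ L₂ v ν₁ ⟶ sumLam L₁ L₂ v ν₂)
  | .inl v, ν₁, _, ε => eqToHom (twist_comp_sumLam_inl L₁ L₂ ν₁.isPostLog v ν₁) ≫
      NatTrans.prod (L₁.iota v ε) (L₂.twistToId ν₁.isPostLog)
  | .inr v, ν₁, _, ε => eqToHom (twist_comp_sumLam_inr L₁ L₂ ν₁.isPostLog v ν₁) ≫
      NatTrans.prod (L₁.twistToId ν₁.isPostLog) (L₂.iota v ε)

/-- `𝒩⊢⊞_w → 𝒩⊢_w`: `forgetMono₁ × 𝟭` resp. `𝟭 × forgetMono₂`. [cite: MochizukiAbsTopIII2015, Def 5.6 (iv) p. 136] -/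
def sumForgetMono : (w : V₁ ⊕ V₂) → (sumNmonoPlusCat L₁ L₂ w ⥤ sumNmonoCat L₁ L₂ w)
  | .inl w => (L₁.forgetMono w).prod (𝟭 L₂.Emono)
  | .inr w => (𝟭 L₁.Emono).prod (L₂.forgetMono w)

/-- `𝒩⊢_w → ℰ⊢ = ℰ⊢₁ × ℰ⊢₂`: `toEmono₁ × 𝟭` resp. `𝟭 × toEmono₂`. [cite: MochizukiAbsTopIII2015, Def 5.6 (iv) p. 136] -/
def sumToEmono : (w : V₁ ⊕ V₂) → (sumNmonoCat L₁ L₂ w ⥤ L₁.Emono × L₂.Emono)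
  | .inl w => (L₁.toEmono w).prod (𝟭 L₂.Emono)
  | .inr w => (𝟭 L₁.Emono).prod (L₂.toEmono w)

/-- `𝒩⊞_v → 𝒩⊢⊞_v`: `monoNplus₁ × (proj₂ ⋙ monoAn₂)` resp. symmetric — the carried global object is mono-analyticised.
[cite: MochizukiAbsTopIII2015, Def 5.6 (iv) p. 136] -/
def sumMonoNplus : (v : V₁ ⊕ V₂) → (sumNplusCat L₁ L₂ v ⥤ sumNmonoPlusCat L₁ L₂ v)
  | .inl v => (L₁.monoNplus v).prod (L₂.proj ⋙ L₂.monoAn)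
  | .inr v => (L₁.proj ⋙ L₁.monoAn).prod (L₂.monoNplus v)

/-- `𝒩_v → 𝒩⊢_v`: `monoN₁ × (proj₂ ⋙ monoAn₂)` resp. symmetric. [cite: MochizukiAbsTopIII2015, Def 5.6 (iv) p. 136] -/
def sumMonoN : (v : V₁ ⊕ V₂) → (sumNCat L₁ L₂ v ⥤ sumNmonoCat L₁ L₂ v)
  | .inl v => (L₁.monoN v).prod (L₂.proj ⋙ L₂.monoAn)
  | .inr v => (L₁.proj ⋙ L₁.monoAn).prod (L₂.monoN v)

/-- The rows-3→4 homotopy of the sum: `monoHomotopy₁ × (canonical unitors)` resp. symmetric.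
[cite: MochizukiAbsTopIII2015, Def 5.6 (iv) p. 136] -/
def sumMonoHomotopy : (v : V₁ ⊕ V₂) →
    (sumMonoNplus L₁ L₂ v ⋙ sumForgetMono L₁ L₂ v ≅ sumForget L₁ L₂ v ⋙ sumMonoN L₁ L₂ v)
  | .inl v => NatIso.prod (L₁.monoHomotopy v)
      ((L₂.proj ⋙ L₂.monoAn).rightUnitor ≪≫ ((L₂.proj ⋙ L₂.monoAn).leftUnitor).symm)
  | .inr v => NatIso.prod ((L₁.proj ⋙ L₁.monoAn).rightUnitor ≪≫ ((L₁.proj ⋙ L₁.monoAn).leftUnitor).symm)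
      (L₂.monoHomotopy v)

/-- **`ψ^{An⊢⊞}_{w,ν}` of the sum**: `ψ₁ × κ₂⁻¹` at `inl w` (the GENUINE row of the first factor; the second factor's object of
`An⊢` read back in `ℰ⊢₂` through its own equivalence), symmetric at `inr w`. [cite: MochizukiAbsTopIII2015, Prop 5.8 (vii) p. 141] -/
def sumψAnMono : (w : V₁ ⊕ V₂) → {ν : LogVertex (Sum.elim isArc₁ isArc₂ w) // ν.IsCross} →
    (L₁.AnMono × L₂.AnMono ⥤ sumNmonoPlusCat L₁ L₂ w)
  | .inl w, ν => (L₁.ψAnMono w ν).prod L₂.κAnMono.inverse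
  | .inr w, ν => L₁.κAnMono.inverse.prod (L₂.ψAnMono w ν)

end Local

/-! ## §2. The sum of two settings -/

section Sum

variable {V₁ V₂ : Type u} {isArc₁ : V₁ → Bool} {isArc₂ : V₂ → Bool}
  (L₁ : LogFrobeniusSetting V₁ isArc₁) (L₂ : LogFrobeniusSetting V₂ isArc₂)

/-- ★ **The SUM of two log-Frobenius settings over the disjoint union of their index sets** (module docstring): global
categories the products, at each place its own factor's local row with the other factor carried as global data.
[cite: MochizukiAbsTopIII2015, Def 5.4 (ii) p. 125] -/
def sum : LogFrobeniusSetting (V₁ ⊕ V₂) (Sum.elim isArc₁ isArc₂) where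
  X := L₁.X × L₂.X
  E := L₁.E × L₂.E
  proj := L₁.proj.prod L₂.proj
  log := L₁.log.prod L₂.log
  logIsoId := NatIso.prod L₁.logIsoId L₂.logIsoId
  logOver := NatIso.prod L₁.logOver L₂.logOver
  Nplus v := sumNplusCat L₁ L₂ v
  N v := sumNCat L₁ L₂ v
  forget := sumForget L₁ L₂
  toE := sumToE L₁ L₂
  lam := sumLam L₁ L₂
  lamOver := sumLamOver L₁ L₂
  lam_spaceLink_eq_postLog := sumLam_spaceLink_eq_postLog L₁ L₂
  iota v _ _ ε := sumIota L₁ L₂ v ε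
  An := L₁.An × L₂.An
  κAn := L₁.κAn.prod L₂.κAn
  φAn := L₁.φAn.prod L₂.φAn
  φAn_isEquivalence :=
    haveI := L₁.φAn_isEquivalence
    haveI := L₂.φAn_isEquivalence
    (L₁.φAn.asEquivalence.prod L₂.φAn.asEquivalence).isEquivalence_functor
  ηAn := NatIso.prod L₁.ηAn L₂.ηAn
  κAn₂ := L₁.κAn₂.prod L₂.κAn₂
  Emono := L₁.Emono × L₂.Emono
  monoAn := L₁.monoAn.prod L₂.monoAn
  NmonoPlus w := sumNmonoPlusCat L₁ L₂ w
  Nmono w := sumNmonoCat L₁ L₂ w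
  forgetMono := sumForgetMono L₁ L₂
  toEmono := sumToEmono L₁ L₂
  monoNplus := sumMonoNplus L₁ L₂
  monoN := sumMonoN L₁ L₂
  monoHomotopy := sumMonoHomotopy L₁ L₂
  AnMono := L₁.AnMono × L₂.AnMono
  κAnMono := L₁.κAnMono.prod L₂.κAnMono
  ψAnMono := sumψAnMono L₁ L₂

/-- `𝒳` of the sum is `𝒳₁ × 𝒳₂` (global). [cite: MochizukiAbsTopIII2015, Def 5.4 (ii) p. 125] -/
theorem sum_X : (L₁.sum L₂).X = (L₁.X × L₂.X) := rfl

/-- `ℰ⊢` and `An⊢` of the sum are the products (global). [cite: MochizukiAbsTopIII2015, Prop 5.8 (vii) p. 141] -/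
theorem sum_Emono_AnMono : (L₁.sum L₂).Emono = (L₁.Emono × L₂.Emono) ∧ (L₁.sum L₂).AnMono = (L₁.AnMono × L₂.AnMono) :=
  ⟨rfl, rfl⟩

/-- `λ⊞` at a place of the first index set: `λ₁ × 𝟭`. [cite: MochizukiAbsTopIII2015, Def 5.4 (iv) p. 127] -/
theorem sum_lam_inl (v : V₁) (ν : LogVertex (isArc₁ v)) :
    (L₁.sum L₂).lam (.inl v) ν = (L₁.lam v ν).prod (𝟭 L₂.X) := rfl

/-- `λ⊞` at a place of the second index set: `𝟭 × λ₂`. [cite: MochizukiAbsTopIII2015, Def 5.4 (iv) p. 127] -/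
theorem sum_lam_inr (v : V₂) (ν : LogVertex (isArc₂ v)) :
    (L₁.sum L₂).lam (.inr v) ν = (𝟭 L₁.X).prod (L₂.lam v ν) := rfl

/-- `ψ^{An⊢⊞}` at a place of the first index set: `ψ₁ × κ₂⁻¹`. [cite: MochizukiAbsTopIII2015, Prop 5.8 (vii) p. 141] -/
theorem sum_ψAnMono_inl (w : V₁) (ν : {ν : LogVertex (isArc₁ w) // ν.IsCross}) :
    (L₁.sum L₂).ψAnMono (.inl w) ν = (L₁.ψAnMono w ν).prod L₂.κAnMono.inverse := rfl

/-- `ψ^{An⊢⊞}` at a place of the second index set: `κ₁⁻¹ × ψ₂`. [cite: MochizukiAbsTopIII2015, Prop 5.8 (vii) p. 141] -/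
theorem sum_ψAnMono_inr (w : V₂) (ν : {ν : LogVertex (isArc₂ w) // ν.IsCross}) :
    (L₁.sum L₂).ψAnMono (.inr w) ν = L₁.κAnMono.inverse.prod (L₂.ψAnMono w ν) := rfl

/-- `ι⊞` at a place of the first index set, unfolded. [cite: MochizukiAbsTopIII2015, Def 5.4 (vii) p. 128] -/
theorem sum_iota_inl (v : V₁) {ν₁ ν₂ : LogVertex (isArc₁ v)} (ε : LogEdge (isArc₁ v) ν₁ ν₂) :
    (L₁.sum L₂).iota (.inl v) ε =
      eqToHom (twist_comp_sumLam_inl L₁ L₂ ν₁.isPostLog v ν₁) ≫ NatTrans.prod (L₁.iota v ε) (L₂.twistToId ν₁.isPostLog) :=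
  rfl

/-- `ι⊞` at a place of the second index set, unfolded. [cite: MochizukiAbsTopIII2015, Def 5.4 (vii) p. 128] -/
theorem sum_iota_inr (v : V₂) {ν₁ ν₂ : LogVertex (isArc₂ v)} (ε : LogEdge (isArc₂ v) ν₁ ν₂) :
    (L₁.sum L₂).iota (.inr v) ε =
      eqToHom (twist_comp_sumLam_inr L₁ L₂ ν₁.isPostLog v ν₁) ≫ NatTrans.prod (L₁.twistToId ν₁.isPostLog) (L₂.iota v ε) :=
  rfl

/-- The mono-analyticization of the sum is the product (global). [cite: MochizukiAbsTopIII2015, Def 5.6 (ii) p. 135] -/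
theorem sum_monoAn : (L₁.sum L₂).monoAn = L₁.monoAn.prod L₂.monoAn := rfl

/-- `monoNplus` at a place of the first index set: `monoNplus₁ × (proj₂ ⋙ monoAn₂)`. [cite: MochizukiAbsTopIII2015, Def 5.6 (iv) p. 136] -/
theorem sum_monoNplus_inl (v : V₁) : (L₁.sum L₂).monoNplus (.inl v) = (L₁.monoNplus v).prod (L₂.proj ⋙ L₂.monoAn) := rfl

/-- `monoNplus` at a place of the second index set. [cite: MochizukiAbsTopIII2015, Def 5.6 (iv) p. 136] -/
theorem sum_monoNplus_inr (v : V₂) : (L₁.sum L₂).monoNplus (.inr v) = (L₁.proj ⋙ L₁.monoAn).prod (L₂.monoNplus v) := rfl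

/-! ## §3. The add-ons of the sum from those of the factors -/

variable {L₁ L₂}

/-- abc-iut-L4-t3's `MonoAnalyticizationHomotopies` of the sum from those of the factors: rows 4→5 at `inl v` is
`M₁.toE v × (unitor)`, rows 6→7 is the product. [cite: MochizukiAbsTopIII2015, Cor 5.10 p. 146] -/
def sumMonoAnalyticizationHomotopies (M₁ : L₁.MonoAnalyticizationHomotopies) (M₂ : L₂.MonoAnalyticizationHomotopies) :
    (L₁.sum L₂).MonoAnalyticizationHomotopies where
  toE
    | .inl v => NatIso.prod (M₁.toE v) (L₂.proj ⋙ L₂.monoAn).rightUnitor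
    | .inr v => NatIso.prod (L₁.proj ⋙ L₁.monoAn).rightUnitor (M₂.toE v)
  anToE := NatIso.prod M₁.anToE M₂.anToE

/-- **Cor 5.10 (iv)(a) for the sum** (`V₁ ⊕ V₂ ≠ ∅`), from the factors' mono-analyticization homotopies.
[cite: MochizukiAbsTopIII2015, Cor 5.10 (iv)(a) p. 147] -/
theorem sum_cor510MonoCores [Nonempty (V₁ ⊕ V₂)] (M₁ : L₁.MonoAnalyticizationHomotopies)
    (M₂ : L₂.MonoAnalyticizationHomotopies) : (L₁.sum L₂).Cor510MonoCores :=
  cor510MonoCores_holds (sumMonoAnalyticizationHomotopies M₁ M₂)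

/-- The `hψ` of the sum: "`ψ` lies over `ℰ⊢`" at `inl w` is `hψ₁ × 𝟙` (the carried factor `κ₂⁻¹ ⋙ 𝟭 ⋙ 𝟭` IS `κ₂⁻¹`).
[cite: MochizukiAbsTopIII2015, Definition 5.6 (iv) p. 136] -/
def sumψOverIso
    (hψ₁ : ∀ (w : V₁) (j : {ν : LogVertex (isArc₁ w) // ν.IsCross}),
      L₁.ψAnMono w j ⋙ L₁.forgetMono w ⋙ L₁.toEmono w ≅ L₁.κAnMono.inverse)
    (hψ₂ : ∀ (w : V₂) (j : {ν : LogVertex (isArc₂ w) // ν.IsCross}),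
      L₂.ψAnMono w j ⋙ L₂.forgetMono w ⋙ L₂.toEmono w ≅ L₂.κAnMono.inverse) :
    ∀ (w : V₁ ⊕ V₂) (j : {ν : LogVertex (Sum.elim isArc₁ isArc₂ w) // ν.IsCross}),
      (L₁.sum L₂).ψAnMono w j ⋙ (L₁.sum L₂).forgetMono w ⋙ (L₁.sum L₂).toEmono w ≅ (L₁.sum L₂).κAnMono.inverse
  | .inl w, j => NatIso.prod (hψ₁ w j) (Iso.refl L₂.κAnMono.inverse)
  | .inr w, j => NatIso.prod (Iso.refl L₁.κAnMono.inverse) (hψ₂ w j)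

/-- The second component of the sum's `hψ` at `inl w` is the identity on objects. [cite: MochizukiAbsTopIII2015, Definition 5.6 (iv) p. 136] -/
theorem sumψOverIso_inl_hom_app_snd
    (hψ₁ : ∀ (w : V₁) (j : {ν : LogVertex (isArc₁ w) // ν.IsCross}),
      L₁.ψAnMono w j ⋙ L₁.forgetMono w ⋙ L₁.toEmono w ≅ L₁.κAnMono.inverse)
    (hψ₂ : ∀ (w : V₂) (j : {ν : LogVertex (isArc₂ w) // ν.IsCross}),
      L₂.ψAnMono w j ⋙ L₂.forgetMono w ⋙ L₂.toEmono w ≅ L₂.κAnMono.inverse)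
    (w : V₁) (j : {ν : LogVertex (isArc₁ w) // ν.IsCross}) (X : L₁.AnMono × L₂.AnMono) :
    ((sumψOverIso hψ₁ hψ₂ (.inl w) j).hom.app X).2 = 𝟙 (L₂.κAnMono.inverse.obj X.2) := rfl

/-- … and at `inr w` the first component is. [cite: MochizukiAbsTopIII2015, Definition 5.6 (iv) p. 136] -/
theorem sumψOverIso_inr_hom_app_fst
    (hψ₁ : ∀ (w : V₁) (j : {ν : LogVertex (isArc₁ w) // ν.IsCross}),
      L₁.ψAnMono w j ⋙ L₁.forgetMono w ⋙ L₁.toEmono w ≅ L₁.κAnMono.inverse)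
    (hψ₂ : ∀ (w : V₂) (j : {ν : LogVertex (isArc₂ w) // ν.IsCross}),
      L₂.ψAnMono w j ⋙ L₂.forgetMono w ⋙ L₂.toEmono w ≅ L₂.κAnMono.inverse)
    (w : V₂) (j : {ν : LogVertex (isArc₂ w) // ν.IsCross}) (X : L₁.AnMono × L₂.AnMono) :
    ((sumψOverIso hψ₁ hψ₂ (.inr w) j).hom.app X).1 = 𝟙 (L₁.κAnMono.inverse.obj X.1) := rfl

section Iota

variable {hψ₁ : ∀ (w : V₁) (j : {ν : LogVertex (isArc₁ w) // ν.IsCross}),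
    L₁.ψAnMono w j ⋙ L₁.forgetMono w ⋙ L₁.toEmono w ≅ L₁.κAnMono.inverse}
  {hψ₂ : ∀ (w : V₂) (j : {ν : LogVertex (isArc₂ w) // ν.IsCross}),
    L₂.ψAnMono w j ⋙ L₂.forgetMono w ⋙ L₂.toEmono w ≅ L₂.κAnMono.inverse}
  (I₁ : L₁.IotaAnMono hψ₁) (I₂ : L₂.IotaAnMono hψ₂)

/-- `ι^{An⊢⊞}_{w,ε}` of the sum: `ι₁ × 𝟙` at `inl w`, `𝟙 × ι₂` at `inr w`. [cite: MochizukiAbsTopIII2015, Prop 5.8 (vii) p. 142] -/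
def sumIotaι : (w : V₁ ⊕ V₂) → {ν₁ ν₂ : LogVertex (Sum.elim isArc₁ isArc₂ w)} →
    (ε : LogEdgeTS (Sum.elim isArc₁ isArc₂ w) ν₁ ν₂) → (hε : ε.InCore) →
    ((L₁.sum L₂).ψAnMono w ⟨ν₁, hε.isCross_src⟩ ⟶ (L₁.sum L₂).ψAnMono w ⟨ν₂, hε.isCross_tgt⟩)
  | .inl w, _, _, ε, hε => NatTrans.prod (I₁.ι w ε hε) (𝟙 L₂.κAnMono.inverse)
  | .inr w, _, _, ε, hε => NatTrans.prod (𝟙 L₁.κAnMono.inverse) (I₂.ι w ε hε)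

/-- It lies over the identity of `Th⊢[Z] = ℰ⊢₁ × ℰ⊢₂` (componentwise: `ι_over` of the factor, identity on the carried object).
[cite: MochizukiAbsTopIII2015, Prop 5.8 (vii) p. 142] -/
theorem sumIotaι_over : ∀ (w : V₁ ⊕ V₂) {ν₁ ν₂ : LogVertex (Sum.elim isArc₁ isArc₂ w)}
    (ε : LogEdgeTS (Sum.elim isArc₁ isArc₂ w) ν₁ ν₂) (hε : ε.InCore) (X : (L₁.sum L₂).AnMono),
    ((L₁.sum L₂).toEmono w).map (((L₁.sum L₂).forgetMono w).map ((sumIotaι I₁ I₂ w ε hε).app X)) =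
      (sumψOverIso hψ₁ hψ₂ w ⟨ν₁, hε.isCross_src⟩).hom.app X ≫ (sumψOverIso hψ₁ hψ₂ w ⟨ν₂, hε.isCross_tgt⟩).inv.app X
  | .inl w, _, _, ε, hε, X => Prod.ext (I₁.ι_over w ε hε X.1) (Category.id_comp _).symm
  | .inr w, _, _, ε, hε, X => Prod.ext (Category.id_comp _).symm (I₂.ι_over w ε hε X.2)

/-- ★ **abc-iut-L4-t3's add-on `ι^{An⊢⊞}` is inherited by the sum**: `ι₁ × 𝟙` at `inl w`, `𝟙 × ι₂` at `inr w` (each place reads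
its own factor's GENUINE `ι^{An⊢⊞}`; "over `Th⊢[Z]`" componentwise). [cite: MochizukiAbsTopIII2015, Prop 5.8 (vii) p. 142] -/
def sumIotaAnMono : (L₁.sum L₂).IotaAnMono (sumψOverIso hψ₁ hψ₂) where
  ι := sumIotaι I₁ I₂
  ι_over := sumIotaι_over I₁ I₂

/-- `ι^{An⊢⊞}` of the sum at `inl w`, unfolded. [cite: MochizukiAbsTopIII2015, Prop 5.8 (vii) p. 142] -/
theorem sumIotaAnMono_ι_inl (w : V₁) {ν₁ ν₂ : LogVertex (isArc₁ w)} (ε : LogEdgeTS (isArc₁ w) ν₁ ν₂) (hε : ε.InCore) :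
    (sumIotaAnMono I₁ I₂).ι (.inl w) ε hε = NatTrans.prod (I₁.ι w ε hε) (𝟙 L₂.κAnMono.inverse) := rfl

/-- `ι^{An⊢⊞}` of the sum at `inr w`, unfolded. [cite: MochizukiAbsTopIII2015, Prop 5.8 (vii) p. 142] -/
theorem sumIotaAnMono_ι_inr (w : V₂) {ν₁ ν₂ : LogVertex (isArc₂ w)} (ε : LogEdgeTS (isArc₂ w) ν₁ ν₂) (hε : ε.InCore) :
    (sumIotaAnMono I₁ I₂).ι (.inr w) ε hε = NatTrans.prod (𝟙 L₁.κAnMono.inverse) (I₂.ι w ε hε) := rfl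

end Iota

end Sum

end LogFrobeniusSetting

end Literature.AnabelianGeometry.AbsoluteAnabelian

end
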